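import Mathlib
import HarnessLib
import Literature.Computability.AlgebraicComplexity.LaserComponentTools
import Summits.MatrixMultiplication.MatrixMultiplication.Theorems.OutsiderSandwichSquaredLaserBlocks
import Summits.MatrixMultiplication.MatrixMultiplication.Theorems.OutsiderSandwichCouplingItems
import Summits.MatrixMultiplication.MatrixMultiplication.Theorems.OutsiderSandwichBlockOneItems

/-!
# OutsiderSandwich — the squared laser packing of `cw₂ ⊗ cw₂` (decomp-mm lens-4, g18)

Kernel (2/2) of node g18 of the lineage `decomp-mm-lens-4` on
`route-MatrixMultiplication-OutsiderSandwich`: the PROOF of item 28195 `SquaredLaserPacking`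
(Coppersmith–Winograd's squaring, CW90 §7 with `q = 2`, read as a restriction statement with
general — not matrix — components):

  `∀ ε > 0, ∀ N₀, ∃ N ≥ N₀, ∃ B, (cw₂^{⊠2})^{⊠9N} ≥ ⟨B⟩ ⊗ (⟨2,2,2⟩^{⊠2N} ⊠ C^{⊠2N})` and
  `3^{18N} ≤ B · 2^{(16+ε)N}`,

where `C = C₁ ⊠ C₂ ⊠ C₃` is the coupling tensor of the three coupled blocks of `cw₂ ⊗ cw₂` under the
merged blocking `{x₀₀}, {x₀ᵢ, xᵢ₀}, {xᵢⱼ}` (`Theorems/OutsiderSandwichCoupling.lean`).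

## Proof

The blocks, the tight support `S = {(i,j,l) : i + j + l = 2}` and the zero-out of the SORTED block
`t^{⊗9N}(w₀) ≥ ⟨2,2,2⟩^{⊠2N} ⊠ C^{⊠2N}` are in the route-independent file
`Theorems/OutsiderSandwichSquaredLaserBlocks.lean` (1/2).  Here: the corner distribution `P`
(pure blocks `1/9`, coupled blocks `2/9`) has all three marginals `(4/9, 4/9, 1/9)`, entropy
`2 log₂ 3 − 16/9`, and is of product form on `S` (`P(i,j,l) = f(i)f(j)f(l)`, `f = (2, 1/3, 1/36)`),
so Le Gall's penalty vanishes (`maxEntropyPenalty_eq_zero_of_mul`).  The tree's effective laser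
method (`exists_free_diagonal_jointType_card`, Le Gall Lemma A.2, and
`tensorRestrictsTo_kroneckerPow_multiple_laserBlock`) gives, for the power `9N` and the joint type
`Q = N · cnt`, a free diagonal `Δ` with `(cw₂^{⊠2})^{⊗9N} ≥ ⟨|Δ|⟩ ⊗ t^{⊗9N}(w₀)` and
`3^{18N} 2^{−16N} ≤ |Δ| · J(9N)`, `J` subexponential (`exists_errTerm_le_mul` makes `J ≤ 2^{εN}`
with `N` a multiple of `max N₀ 1`).

Consequences (over the route decls, all now UNCONDITIONAL): `SquaredLaserFloor` (item 28196),
`LaserDescent` with its hypothesis discharged, `LaserMergeOptimal ⟹ CouplingMergeOptimal ⟹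
BlockOneMergeOptimal`, and `CouplingTangency`, `CouplingIsMM`, `BlockOneTangency`, `BlockOneIsMM`
each `⟹ LaserTangency` — so the one-block cut `closes(BlockOneTangency, BlockOneMergeOptimal,
SummitIffBlockOne)` DOMINATES the cut of record `closes(LaserTangency, LaserMergeOptimal,
SummitIffLaserTangency)`: attacked piece at least as strong toward the crux of record, residual
WEAKER (implied by the residual of record).

References: [CoppersmithWinograd1990, §6–§7]; [BurgisserClausenShokrollahi1997, Prop. 15.30,
(15.32), Thm. 15.41]; [LeGall2014, Thm. 4.1, Prop. 4.1, Appendix A]; [Strassen1991];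
[Blaser2013, Def. 7.2].
-/

noncomputable section

open scoped BigOperators
open Literature.Computability.AlgebraicComplexity
open Summit.MatrixMultiplication.MatrixMultiplication.Theorems.OutsiderSandwichSquaredLaserBlocks

namespace Summit.MatrixMultiplication.MatrixMultiplication.Theorems.OutsiderSandwichSquaredLaserPacking

/-! ## 4. The corner distribution: marginals `(4/9, 4/9, 1/9)`, entropy `2 log₂ 3 − 16/9`, no penalty -/

/-- The letter counts of the pattern as a table `cntTable i j l`. -/
def cntTable : Fin 3 → Fin 3 → Fin 3 → ℕ :=
  ![![![0, 0, 1], ![0, 2, 0], ![1, 0, 0]],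
    ![![0, 2, 0], ![2, 0, 0], ![0, 0, 0]],
    ![![1, 0, 0], ![0, 0, 0], ![0, 0, 0]]]

/-- The letter counts agree with the table. -/
theorem cnt_eq_table (s : Fin 3 × Fin 3 × Fin 3) : cnt s = cntTable s.1 s.2.1 s.2.2 := by
  revert s; decide

/-- The corner distribution `P = cnt / 9`: `1/9` on each pure block, `2/9` on each coupled block. -/
def cornerDist : Fin 3 × Fin 3 × Fin 3 → ℝ := fun s => (cnt s : ℝ) / 9

/-- Entries of the corner distribution. -/
theorem cornerDist_apply (i j l : Fin 3) : cornerDist (i, j, l) = (cntTable i j l : ℝ) / 9 := by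
  rw [cornerDist, cnt_eq_table]

/-- First marginal `(4/9, 4/9, 1/9)`. -/
theorem marginalDist₁_corner : marginalDist₁ cornerDist = ![4 / 9, 4 / 9, 1 / 9] := by
  funext i
  simp only [marginalDist₁, Fin.sum_univ_three, cornerDist_apply]
  fin_cases i <;> simp [cntTable] <;> norm_num

/-- Second marginal `(4/9, 4/9, 1/9)`. -/
theorem marginalDist₂_corner : marginalDist₂ cornerDist = ![4 / 9, 4 / 9, 1 / 9] := by
  funext j
  simp only [marginalDist₂, Fin.sum_univ_three, cornerDist_apply]
  fin_cases j <;> simp [cntTable] <;> norm_num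

/-- Third marginal `(4/9, 4/9, 1/9)`. -/
theorem marginalDist₃_corner : marginalDist₃ cornerDist = ![4 / 9, 4 / 9, 1 / 9] := by
  funext l
  simp only [marginalDist₃, Fin.sum_univ_three, cornerDist_apply]
  fin_cases l <;> simp [cntTable] <;> norm_num

/-- `H(4/9, 4/9, 1/9) = 2 log₂ 3 − 16/9`. -/
theorem shannonEntropy_corner :
    shannonEntropy (![4 / 9, 4 / 9, 1 / 9] : Fin 3 → ℝ) = 2 * Real.log 3 / Real.log 2 - 16 / 9 := by
  have hlog2 : Real.log 2 ≠ 0 := (Real.log_pos one_lt_two).ne'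
  have h49 : Real.log (4 / 9 : ℝ) = 2 * Real.log 2 - 2 * Real.log 3 := by
    rw [Real.log_div (by norm_num) (by norm_num), show (4 : ℝ) = 2 ^ 2 by norm_num,
      show (9 : ℝ) = 3 ^ 2 by norm_num, Real.log_pow, Real.log_pow]
    push_cast; ring
  have h19 : Real.log (1 / 9 : ℝ) = -(2 * Real.log 3) := by
    rw [Real.log_div one_ne_zero (by norm_num), Real.log_one, show (9 : ℝ) = 3 ^ 2 by norm_num,
      Real.log_pow]
    push_cast; ring
  rw [shannonEntropy_def, Fin.sum_univ_three]
  simp only [Matrix.cons_val_zero, Matrix.cons_val_one, Matrix.cons_val, Real.negMulLog, h49, h19]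
  field_simp
  ring

/-- The corner distribution is a probability distribution. -/
theorem cornerDist_mem_stdSimplex : cornerDist ∈ stdSimplex ℝ (Fin 3 × Fin 3 × Fin 3) := by
  refine ⟨fun s => by unfold cornerDist; positivity, ?_⟩
  simp only [cornerDist]
  rw [← Finset.sum_div, ← Nat.cast_sum, sum_cnt]
  norm_num

/-- The corner distribution is supported in `S`. -/
theorem cornerDist_eq_zero (s : Fin 3 × Fin 3 × Fin 3) (hs : s ∉ mergedSupport) : cornerDist s = 0 := by
  simp [cornerDist, cnt_eq_zero s hs]

/-- The product-form factor `f = (2, 1/3, 1/36)`: `P(i,j,l) = f(i) f(j) f(l)` on `S`. -/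
def pf : Fin 3 → ℝ := ![2, 1 / 3, 1 / 36]

/-- The product-form factors are positive. -/
theorem pf_pos (i : Fin 3) : 0 < pf i := by
  fin_cases i <;> simp [pf]

/-- Product form of the corner distribution on `S`. -/
theorem cornerDist_prod : ∀ x ∈ mergedSupport, cornerDist x = pf x.1 * pf x.2.1 * pf x.2.2 := by
  intro x hx
  rw [mergedSupport_eq] at hx
  simp only [Finset.mem_insert, Finset.mem_singleton] at hx
  rcases hx with rfl | rfl | rfl | rfl | rfl | rfl <;>
    simp [cornerDist_apply, cntTable, pf] <;> norm_num

/-- **Le Gall's penalty vanishes at the corner distribution** (product form). -/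
theorem maxEntropyPenalty_corner : maxEntropyPenalty mergedSupport cornerDist = 0 :=
  maxEntropyPenalty_eq_zero_of_mul mergedSupport cornerDist_mem_stdSimplex cornerDist_eq_zero pf pf pf
    (fun _ _ => pf_pos _) (fun _ _ => pf_pos _) (fun _ _ => pf_pos _) cornerDist_prod

/-! ## 5. The packing -/

/-- The restated coupling tensor of the blocks file IS the kernel's `couplingTensor`. -/
theorem cplTensor_eq : cplTensor = OutsiderSandwichCoupling.couplingTensor := rfl

/-- **SquaredLaserPacking** (Coppersmith–Winograd's squaring for `q = 2`, as a restriction statement):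
`∀ ε > 0, ∀ N₀, ∃ N ≥ N₀, ∃ B, (cw₂^{⊠2})^{⊠9N} ≥ ⟨B⟩ ⊗ (⟨2,2,2⟩^{⊠2N} ⊠ C^{⊠2N})` with
`3^{18N} ≤ B · 2^{(16+ε)N}`. [cite: CoppersmithWinograd1990, §7] -/
theorem squaredLaserPacking : OutsiderSandwichCoupling.SquaredLaserPacking := by
  classical
  intro ε hε N₀
  -- constants of the counting bound
  set G : ℕ := Fintype.card (Fin 3 × Fin 3 × Fin 3) with hG
  set A : ℕ := Fintype.card (Fin 3) + Fintype.card (Fin 3) + Fintype.card (Fin 3) with hA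
  set b' : ℕ := max 4 1 with hb'
  have hu : 0 ≤ Real.log ((3 * b' : ℕ) : ℝ) := Real.log_natCast_nonneg _
  have hlogG : 0 ≤ Real.log (G : ℝ) := Real.log_natCast_nonneg _
  have hlog2 : 0 < Real.log 2 := Real.log_pos one_lt_two
  have hη : 0 < ε * Real.log 2 / 9 := by positivity
  -- the power: `N = K M`, `K = max N₀ 1`, `M` large
  set K : ℕ := max N₀ 1 with hK
  have hK0 : 0 < K := lt_of_lt_of_le one_pos (le_max_right _ _)
  have hd : 0 < 9 * K := by omega
  obtain ⟨M, hM1, hM⟩ := exists_errTerm_le_mul (a := ((2 * G + A : ℕ) : ℝ)) (e := 4)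
    (u := Real.log ((3 * b' : ℕ) : ℝ)) (v := Real.log (G : ℝ)) (w := Real.log (96 * (b' : ℝ)))
    (η := ε * Real.log 2 / 9) (Nat.cast_nonneg _) (by norm_num) hu hlogG hη hd
  refine ⟨K * M, le_trans (le_max_left N₀ 1) (Nat.le_mul_of_pos_right K (by omega)), ?_⟩
  obtain ⟨N, hN⟩ : ∃ N : ℕ, N = K * M := ⟨_, rfl⟩
  rw [← hN]
  have hN0 : 0 < N := hN ▸ Nat.mul_pos hK0 (by omega)
  have hdM : 9 * K * M = 9 * N := by rw [hN]; exact Nat.mul_assoc _ _ _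
  rw [hdM] at hM
  have h9N : 0 < 9 * N := by omega
  have h9N' : ((9 * N : ℕ) : ℝ) ≠ 0 := by exact_mod_cast h9N.ne'
  -- the joint type `Q = N · cnt` and the corner distribution `P = Q / 9N`
  have hQS : ∀ s, s ∉ mergedSupport → (fun s => N * cnt s) s = 0 := fun s hs => by
    simp only [cnt_eq_zero s hs, mul_zero]
  have hQsum : ∑ s, (fun s => N * cnt s) s = 9 * N := by
    show ∑ s, N * cnt s = 9 * N
    rw [← Finset.mul_sum, sum_cnt, mul_comm]
  have hPQ : ∀ s, cornerDist s = (((fun s => N * cnt s) s : ℕ) : ℝ) / ((9 * N : ℕ) : ℝ) := by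
    intro s
    rw [cornerDist, div_eq_div_iff (by norm_num) h9N']
    push_cast
    ring
  -- the free diagonal of one joint type (Le Gall, Lemma A.2, effective)
  obtain ⟨Δ, hΔQ, hfree, hcount⟩ := exists_free_diagonal_jointType_card (r := 1) (b := 4) mergedSupport
    lab lab lab lab_injective lab_injective lab_injective lab_abs lab_abs lab_tight h9N
    (fun s => N * cnt s) hQS hQsum cornerDist hPQ
  rw [marginalDist₁_corner, marginalDist₂_corner, marginalDist₃_corner, shannonEntropy_corner,
    min_self, min_self, maxEntropyPenalty_corner, sub_zero] at hcount
  -- the restriction `(cw₂^{⊠2})^{⊗9N} ≥ ⟨|Δ|⟩ ⊗ t^{⊗9N}(w₀) ≥ ⟨|Δ|⟩ ⊗ (⟨2,2,2⟩^{⊠2N} ⊠ C^{⊠2N})`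
  have htype : ∀ δ ∈ Δ, letterCount (labelSeq δ) = letterCount (word N) := fun δ hδ => by
    rw [letterCount_word]; exact (Finset.mem_filter.1 (hΔQ hδ)).2
  have hres := tensorRestrictsTo_kroneckerPow_multiple_laserBlock cwSq zc zc zc mergedSupport
    cwSq_support Δ hfree (word N) htype
  rw [← cplTensor_eq]
  refine ⟨Δ.card, hres.trans ((TensorRestrictsTo.refl _).kronecker (laserBlock_restrictsTo N)), ?_⟩
  -- the count: `3^{18N} 2^{-16N} ≤ |Δ| J(9N)` and `J(9N) ≤ 2^{εN}`
  set Jf : ℝ := ((((9 * N : ℕ) : ℝ)) + 1) ^ (2 * Fintype.card (Fin 3 × Fin 3 × Fin 3) +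
      (Fintype.card (Fin 3) + Fintype.card (Fin 3) + Fintype.card (Fin 3))) * (96 * ((max 4 1 : ℕ) : ℝ)) *
    Real.exp (4 * √(Real.log ((3 * max 4 1 : ℕ) : ℝ) +
      ((9 * N : ℕ) : ℝ) * Real.log (Fintype.card (Fin 3 × Fin 3 × Fin 3) : ℝ))) with hJf
  have hJpos : 0 < Jf := by positivity
  have h2pos : 0 < (2 : ℝ) ^ (((9 * N : ℕ) : ℝ) * (2 * Real.log 3 / Real.log 2 - 16 / 9)) :=
    Real.rpow_pos_of_pos two_pos _
  have hΔpos : 0 < (Δ.card : ℝ) := by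
    by_contra h0
    have h0' : (Δ.card : ℝ) = 0 := le_antisymm (not_lt.1 h0) (Nat.cast_nonneg _)
    rw [h0', zero_mul] at hcount
    exact absurd hcount (not_le.2 h2pos)
  have hlogJ : Real.log Jf = ((2 * G + A : ℕ) : ℝ) * Real.log (((9 * N : ℕ) : ℝ) + 1) +
      Real.log (96 * (b' : ℝ)) +
      4 * √(Real.log ((3 * b' : ℕ) : ℝ) + ((9 * N : ℕ) : ℝ) * Real.log (G : ℝ)) := by
    rw [hJf, Real.log_mul (by positivity) (by positivity),
      Real.log_mul (by positivity) (by positivity), Real.log_exp, Real.log_pow, hG, hA, hb']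
  have hJle : Real.log Jf ≤ ε * Real.log 2 / 9 * ((9 * N : ℕ) : ℝ) := by
    rw [hlogJ]
    rw [show Real.log (G : ℝ) * ((9 * N : ℕ) : ℝ) = ((9 * N : ℕ) : ℝ) * Real.log (G : ℝ) from
      mul_comm _ _] at hM
    linarith [hM]
  have hlog := Real.log_le_log h2pos hcount
  rw [Real.log_rpow two_pos, Real.log_mul hΔpos.ne' hJpos.ne'] at hlog
  have key : ((9 * N : ℕ) : ℝ) * (2 * Real.log 3 / Real.log 2 - 16 / 9) * Real.log 2 =
      18 * N * Real.log 3 - 16 * N * Real.log 2 := by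
    push_cast; field_simp; ring
  have h2r : 0 < (2 : ℝ) ^ ((16 + ε) * (N : ℝ)) := Real.rpow_pos_of_pos two_pos _
  rw [← Real.log_le_log_iff (pow_pos three_pos _) (mul_pos hΔpos h2r), Real.log_pow,
    Real.log_mul hΔpos.ne' h2r.ne', Real.log_rpow two_pos]
  push_cast at hlog hJle key ⊢
  linarith [hlog, hJle, key]

/-! ## 6. The route items and the now unconditional descent -/

open Summit.MatrixMultiplication.MatrixMultiplication

/-- **Item 28195 `SquaredLaserPacking` holds.** [cite: CoppersmithWinograd1990, §7] -/
theorem squaredLaserPacking_holds : Theses.OutsiderSandwich.SquaredLaserPacking :=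
  squaredLaserPacking

/-- **Item 28196 `SquaredLaserFloor` holds**: `3¹⁸ F⟨2,2,2⟩² F(C)² ≤ 2¹⁶ F(cw₂)¹⁸` for every universal
spectral point. [cite: CoppersmithWinograd1990, §7] -/
theorem squaredLaserFloor_holds : Theses.OutsiderSandwich.SquaredLaserFloor :=
  OutsiderSandwichCouplingItems.squaredLaserFloor_of_squaredLaserPacking squaredLaserPacking_holds

/-- **Laser descent, unconditional**: `(CouplingTangency ⟹ LaserTangency) ∧
(LaserMergeOptimal ⟹ CouplingMergeOptimal)` (item 28202 with its hypothesis discharged). -/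
theorem laserDescent_unconditional :
    (Theses.OutsiderSandwich.CouplingTangency → Theses.OutsiderSandwich.LaserTangency) ∧
      (Theses.OutsiderSandwich.LaserMergeOptimal → Theses.OutsiderSandwich.CouplingMergeOptimal) :=
  OutsiderSandwichCouplingItems.laserDescent_holds squaredLaserFloor_holds

/-- `LaserMergeOptimal ⟹ CouplingMergeOptimal` (residual 27897 ⟹ residual candidate 28193). -/
theorem couplingMergeOptimal_of_laserMergeOptimal (h : Theses.OutsiderSandwich.LaserMergeOptimal) :
    Theses.OutsiderSandwich.CouplingMergeOptimal :=
  laserDescent_unconditional.2 h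

/-- **`LaserMergeOptimal ⟹ BlockOneMergeOptimal`** (residual of record 27897 ⟹ one-block residual
27149), now hypothesis-free: the one-block cut's residual is WEAKER than the cut of record's. -/
theorem blockOneMergeOptimal_of_laserMergeOptimal (h : Theses.OutsiderSandwich.LaserMergeOptimal) :
    Theses.OutsiderSandwich.BlockOneMergeOptimal :=
  OutsiderSandwichBlockOneItems.blockOneMergeOptimal_iff.2
    (OutsiderSandwichBlockOne.blockMergeOptimal_iff_one.1
      (OutsiderSandwichBlock.blockMergeOptimal_of_couplingMergeOptimal
        (couplingMergeOptimal_of_laserMergeOptimal h)))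

/-- `CouplingTangency ⟹ LaserTangency` (28192 ⟹ crux of record 32268), hypothesis-free. -/
theorem laserTangency_of_couplingTangency (h : Theses.OutsiderSandwich.CouplingTangency) :
    Theses.OutsiderSandwich.LaserTangency :=
  laserDescent_unconditional.1 h

/-- `CouplingIsMM ⟹ LaserTangency` (ω-free leaf 28194 ⟹ crux of record), hypothesis-free. -/
theorem laserTangency_of_couplingIsMM (h : Theses.OutsiderSandwich.CouplingIsMM) :
    Theses.OutsiderSandwich.LaserTangency :=
  OutsiderSandwichCouplingItems.laserTangency_of_couplingIsMM squaredLaserPacking_holds h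

/-- `BlockOneTangency ⟹ LaserTangency` (one-block attacked piece 27148 ⟹ crux of record 32268),
hypothesis-free. -/
theorem laserTangency_of_blockOneTangency (h : Theses.OutsiderSandwich.BlockOneTangency) :
    Theses.OutsiderSandwich.LaserTangency :=
  laserTangency_of_couplingTangency
    (OutsiderSandwichBlock.couplingTangency_of_blockTangency
      (OutsiderSandwichBlockOne.blockTangency_iff_one.2
        (OutsiderSandwichBlockOneItems.blockOneTangency_iff.1 h)))

/-- `BlockOneIsMM ⟹ LaserTangency` (ω-free one-block leaf 27147 ⟹ crux of record), hypothesis-free. -/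
theorem laserTangency_of_blockOneIsMM (h : Theses.OutsiderSandwich.BlockOneIsMM) :
    Theses.OutsiderSandwich.LaserTangency :=
  laserTangency_of_couplingIsMM
    (OutsiderSandwichBlock.couplingIsMM_of_blockIsMM
      (OutsiderSandwichBlockOne.blockIsMM_iff_one.2 (OutsiderSandwichBlockOneItems.blockOneIsMM_iff.1 h)))

end Summit.MatrixMultiplication.MatrixMultiplication.Theorems.OutsiderSandwichSquaredLaserPacking
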